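import Literature.Geometry.Riemannian.GraphMeanCurvatureSecondDerivatives
import Mathlib.Analysis.InnerProductSpace.Adjoint
import HarnessLib

/-!
# Graph maps over a plane are spacelike immersions (K_{2,α} convention)

Topic `Literature/Geometry/Riemannian`.  For a linear isometry `L : E' →ₗᵢ V` onto the plane
`K = range L` and a smooth `u : E' → V` with values in `Kᗮ`, the graph map `f = L + u` is a smooth
injective immersion of the model space `E'` into the Euclidean space `V`
(`isSpacelikeImmersion_graph`, `injective_graph`), with `‖df v‖² = ‖v‖² + ‖Du v‖² ≥ ‖v‖²`
(`norm_sq_mfderiv_graph`).  Glue for the nonparametric description of flows (White 2005, §2.5,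
§8.4).

Everything is PROVED; no definitions, no named facts.

## References

* B. White, *A local regularity theorem for mean curvature flow*, Ann. of Math. 161 (2005),
  §2.5 and §8.4. [White2005]
-/

noncomputable section

open Bundle Set Function Module Filter
open scoped Manifold ContDiff Topology RealInnerProductSpace

namespace Literature.Geometry.Riemannian

open Lorentzian Lorentzian.PseudoRiemannianMetric Submodule

variable {E' V : Type*} [NormedAddCommGroup E'] [InnerProductSpace ℝ E'] [FiniteDimensional ℝ E']
  [NormedAddCommGroup V] [InnerProductSpace ℝ V] [FiniteDimensional ℝ V]

omit [FiniteDimensional ℝ E'] [FiniteDimensional ℝ V] in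
/-- First derivatives of a `Kᗮ`-valued map are `Kᗮ`-valued. [folklore] -/
theorem fderiv_mem_orthogonal (K : Submodule ℝ V) [K.HasOrthogonalProjection] {u : E' → V}
    (hu : Differentiable ℝ u) (hK : ∀ x, u x ∈ Kᗮ) (y v : E') : fderiv ℝ u y v ∈ Kᗮ := by
  have h0 : (fun z => K.starProjection (u z)) = fun _ => (0 : V) := by
    funext z
    rw [starProjection_apply, (orthogonalProjectionOnto_eq_zero_iff).2 (hK z), coe_zero]
  have h1 : fderiv ℝ (fun z => K.starProjection (u z)) y v = K.starProjection (fderiv ℝ u y v) := by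
    rw [show (fun z => K.starProjection (u z)) = K.starProjection ∘ u from rfl,
      fderiv_comp y K.starProjection.differentiableAt (hu y), K.starProjection.fderiv]
    rfl
  have h2 : K.starProjection (fderiv ℝ u y v) = 0 := by
    rw [← h1, h0, fderiv_const_apply]; rfl
  rwa [starProjection_apply, coe_eq_zero, orthogonalProjectionOnto_eq_zero_iff] at h2

omit [FiniteDimensional ℝ E'] [FiniteDimensional ℝ V] in
/-- **Pythagoras for the differential of a graph map**: `‖(L + Du) v‖² = ‖v‖² + ‖Du v‖²`.
[folklore] -/
theorem norm_sq_graph_differential (L : E' →ₗᵢ[ℝ] V) {D : E' →L[ℝ] V}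
    (hD : ∀ v, D v ∈ (LinearMap.range L.toLinearMap)ᗮ) (v : E') :
    ‖L v + D v‖ ^ 2 = ‖v‖ ^ 2 + ‖D v‖ ^ 2 := by
  have horth : ⟪L v, D v⟫ = 0 := hD v (L v) ⟨v, rfl⟩
  rw [← L.norm_map v, sq, sq, sq]
  exact norm_add_sq_eq_norm_sq_add_norm_sq_real horth

/-- The graph map is injective. [folklore] -/
theorem injective_graph (L : E' →ₗᵢ[ℝ] V) {u : E' → V}
    (huK : ∀ x, u x ∈ (LinearMap.range L.toLinearMap)ᗮ) :
    Injective fun x => L x + u x := by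
  intro x y hxy
  -- apply the adjoint `L†` (kills `Kᗮ`, inverts `L`)
  have hadjL : ∀ z : E', L.toContinuousLinearMap.adjoint (L z) = z := fun z => by
    refine ext_inner_right ℝ fun w => ?_
    rw [ContinuousLinearMap.adjoint_inner_left]
    exact L.inner_map_map z w
  have hadj0 : ∀ z ∈ (LinearMap.range L.toLinearMap)ᗮ, L.toContinuousLinearMap.adjoint z = 0 :=
    fun z hz => by
    refine ext_inner_right ℝ fun w => ?_
    rw [ContinuousLinearMap.adjoint_inner_left, inner_zero_left]
    have h := hz (L w) ⟨w, rfl⟩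
    rwa [real_inner_comm] at h
  have h := congrArg L.toContinuousLinearMap.adjoint hxy
  simp only [map_add] at h
  change L.toContinuousLinearMap.adjoint (L x) + _ = L.toContinuousLinearMap.adjoint (L y) + _ at h
  rwa [hadjL, hadjL, hadj0 _ (huK x), hadj0 _ (huK y), add_zero, add_zero] at h

omit [FiniteDimensional ℝ V] in
/-- **Graph maps are spacelike immersions** of the model space into Euclidean space.
[cite: White2005, §2.5] -/
theorem isSpacelikeImmersion_graph (L : E' →ₗᵢ[ℝ] V) {u : E' → V} (hu : ContDiff ℝ ∞ u)
    (huK : ∀ x, u x ∈ (LinearMap.range L.toLinearMap)ᗮ) :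
    (euclideanMetric V).IsSpacelikeImmersion 𝓘(ℝ, E') (fun x => L x + u x) := by
  have hcd : ContDiff ℝ ∞ fun x => L x + u x := L.toContinuousLinearMap.contDiff.add hu
  refine ⟨?_, fun y v hv => ?_⟩
  · have : ((∞ : ℕ∞ω) + 1) = ∞ := by simp
    rw [this]
    exact hcd.contMDiff
  · set v' : E' := v with hv'
    have hv0 : v' ≠ 0 := hv
    have hud : Differentiable ℝ u := hu.differentiable (by simp)
    have hd : (mfderiv 𝓘(ℝ, E') 𝓘(ℝ, V) (fun x => L x + u x) y : E' →L[ℝ] V) =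
        L.toContinuousLinearMap + fderiv ℝ u y := by
      rw [mfderiv_eq_fderiv]
      change fderiv ℝ (fun x => L.toContinuousLinearMap x + u x) y = _
      rw [fderiv_fun_add L.toContinuousLinearMap.differentiableAt (hud y),
        L.toContinuousLinearMap.fderiv]
    have hne : (mfderiv 𝓘(ℝ, E') 𝓘(ℝ, V) (fun x => L x + u x) y : E' →L[ℝ] V) v' ≠ 0 := by
      rw [hd]
      intro h0
      have h1 := norm_sq_graph_differential L (fderiv_mem_orthogonal _ hud huK y) v'
      have h2 : L v' + fderiv ℝ u y v' = 0 := h0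
      rw [h2, norm_zero] at h1
      have h3 : 0 < ‖v'‖ := norm_pos_iff.2 hv0
      nlinarith [sq_nonneg ‖fderiv ℝ u y v'‖]
    rw [inducedBilin_apply, euclideanMetric_apply]
    exact real_inner_self_pos.mpr hne

end Literature.Geometry.Riemannian
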